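import Summits.QuantumFields.YangMills.Theorems.SwapVirialDeficitBlowUpGnomonicFibreCoercivity
import Summits.QuantumFields.YangMills.Theorems.SwapVirialDeficitBlowUpVirialChart
import Summits.QuantumFields.YangMills.Theorems.SwapVirialDeficitQuantitativeLaplaceMeasurableDerivParam
import HarnessLib

/-!
# MEASURABLE RAY DERIVATIVES WITH PARAMETERS — by difference quotients, no joint smoothness — and the gnomonic instance:
# `(a, η₀, ζ) ↦ (d²/ds²) F̂(a, ε, η₀ + s·ζ)|₀` is jointly measurable in the HUB and all data
# (free-hands support of ⟨stmt-QuantumFields-24197⟩ `SwapVirialDeficit.SwapGluedStiffness`; `hAm`∕`det A(p)`-measurability sockets of the bulk fibre package when the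
# hub `a` is part of the base — where `a ↦ ν(axisPoint a)` is continuous but NOT differentiable across the real axis, so the `Continuous f.uncurry`-based Mathlib
# route `measurable_deriv_with_param` does not iterate to second order)

* §1 = the generic prequel ✓`…QuantitativeLaplaceMeasurableDerivParam` (`measurable_deriv_param`, `measurable_iteratedDeriv_two_param`: joint measurability +
  fibrewise `C²`, by difference quotients);
* §2 (model, on fcl-p3 g46's ✓`measurable_gnoDeficit_uncurry`: `(a, η) ↦ gnoDeficit z χ a ε η` jointly measurable) `measurable_gnoRay`, ★★ `measurable_rayDeriv_gnoDeficit_param` ∕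
  ★★ `measurable_raySecond_gnoDeficit_param` — for measurable `hub : α → ℍ` with `hub x ≠ 0`, `base dir : α → GnoCoord L`:
  `x ↦ (d/ds) F̂(hub x, ε, base x + s·dir x)|₀` and `x ↦ (d²/ds²) F̂(hub x, ε, base x + s·dir x)|₀` are measurable (rays are `C^∞` by ✓`contDiff_gnoDeficit_ray`) — with
  `α := M × V`, `base := η₀ ∘ π_M`, `dir := gnoFibreEmb ∘ π_V` this is the `hAm` of ✓`laplaceMethod_quantitative_fibred_chart_cubic_offBound` by
  ✓`iteratedFDeriv_two_eq_lineJet`, INCLUDING a varying hub; by polarisation it is the measurability of every Hessian matrix entry, hence of `p ↦ det A(p)`.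

HONEST LABEL: measure-theoretic plumbing; ⟨24197⟩ (window-uniform) ∕ ⟨24194⟩ ∕ ⟨24497⟩ OPEN; own crux ⟨22884⟩ OPEN (blocked-on ⟨19935⟩); no crux, rung of record or
summit is proved; the Yang–Mills mass gap is NOT proved; no summit is proved by a line.  THEOREMS ONLY (0 `def`, 0 `sorry`), standard axioms; the series' local `ℍ` measurable-space instances.
Width seat ym-line-sfw-p2-w3 g66 (cell ym-idea-1, free hands), `--supports stmt-QuantumFields-24197`.  References: [folklore].
-/

set_option autoImplicit false
set_option synthInstance.maxSize 1024

noncomputable section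

open MeasureTheory Quaternion Filter Topology Function
open scoped BigOperators Quaternion ContDiff
open Literature.MathematicalPhysics.QuantumFieldTheory hiding SU2
open Literature.MathematicalPhysics.QuantumLattice

attribute [local instance] Literature.Analysis.FluidPDE.Tao2016.quatMeasurableSpace
  Literature.Analysis.FluidPDE.Tao2016.quatBorelSpace
  Literature.MathematicalPhysics.QuantumLattice.secondCountableTopology_su2

namespace Summit.QuantumFields.YangMills.Theorems.SwapVirialDeficit.BlowUpRing

open Summit.QuantumFields.YangMills.Theorems.FemtoTransferGap
open Summit.QuantumFields.YangMills.Theorems.FemtoTransferGap.TT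
open Summit.QuantumFields.YangMills.Theorems.VirialFluxGap.RingDeficit
open Summit.QuantumFields.YangMills.Theorems.SwapVirialDeficit.SwapRing

open Summit.QuantumFields.YangMills.Theorems.QuantitativeLaplace (measurable_deriv_param_at measurable_iteratedDeriv_two_param)

/-! ## §2 The gnomonic instance: ray derivatives of `F̂` are jointly measurable in the hub, the base point and the direction -/

variable {L : ℕ} [NeZero L]

section Model

variable {α : Type*} [MeasurableSpace α]

omit [NeZero L] in
/-- The affine ray map `(x, s) ↦ base x + s·dir x` into the gnomonic coordinates is measurable for measurable `base`, `dir` — proved COMPONENTWISE (the instance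
`MeasurableSMul₂ ℝ (GnoCoord L)` is not synthesized on the 4-fold product). [folklore] -/
theorem measurable_gnoRay {base dir : α → GnoCoord L} (hbase : Measurable base) (hdir : Measurable dir) :
    Measurable fun p : α × ℝ => base p.1 + p.2 • dir p.1 := by
  have hb : Measurable fun p : α × ℝ => base p.1 := hbase.comp measurable_fst
  have hd : Measurable fun p : α × ℝ => dir p.1 := hdir.comp measurable_fst
  have hs : Measurable fun p : α × ℝ => p.2 := measurable_snd
  -- a vector component `k` of a letter: `(base + s•dir)… k = base… k + s * dir… k`
  have h3 : ∀ {u v : α × ℝ → Fin 3 → ℝ}, Measurable u → Measurable v → Measurable fun p : α × ℝ => u p + p.2 • v p := by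
    intro u v hu hv
    refine measurable_pi_lambda _ fun k => ?_
    show Measurable fun p : α × ℝ => u p k + p.2 * v p k
    exact ((measurable_pi_apply k).comp hu).add (hs.mul ((measurable_pi_apply k).comp hv))
  refine Measurable.prodMk (Measurable.prodMk ?_ ?_) (Measurable.prodMk ?_ ?_)
  · show Measurable fun p : α × ℝ => (base p.1).1.1 + p.2 • (dir p.1).1.1
    exact h3 (measurable_fst.comp (measurable_fst.comp hb)) (measurable_fst.comp (measurable_fst.comp hd))
  · show Measurable fun p : α × ℝ => (base p.1).1.2 + p.2 • (dir p.1).1.2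
    exact h3 (measurable_snd.comp (measurable_fst.comp hb)) (measurable_snd.comp (measurable_fst.comp hd))
  · show Measurable fun p : α × ℝ => (base p.1).2.1 + p.2 • (dir p.1).2.1
    exact h3 (measurable_fst.comp (measurable_snd.comp hb)) (measurable_fst.comp (measurable_snd.comp hd))
  · show Measurable fun p : α × ℝ => (base p.1).2.2 + p.2 • (dir p.1).2.2
    refine measurable_pi_lambda _ fun f => ?_
    show Measurable fun p : α × ℝ => (base p.1).2.2 f + p.2 • (dir p.1).2.2 f
    exact h3 ((measurable_pi_apply f).comp (measurable_snd.comp (measurable_snd.comp hb)))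
      ((measurable_pi_apply f).comp (measurable_snd.comp (measurable_snd.comp hd)))

/-- The ray family `(x, s) ↦ F̂(hub x, ε, base x + s·dir x)` is jointly measurable for measurable data. [folklore] -/
theorem measurable_gnoDeficit_ray_uncurry (z : Fin 3 → Bool) (χ : Site 3 L → SU2) (ε : GnoSign L) {hub : α → ℍ} (hhub : Measurable hub)
    {base dir : α → GnoCoord L} (hbase : Measurable base) (hdir : Measurable dir) :
    Measurable fun p : α × ℝ => gnoDeficit z χ (hub p.1) ε (base p.1 + p.2 • dir p.1) := by
  have hq : Measurable fun p : α × ℝ => ((hub p.1, base p.1 + p.2 • dir p.1) : ℍ × GnoCoord L) :=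
    (hhub.comp measurable_fst).prodMk (measurable_gnoRay hbase hdir)
  -- (the composition is rewritten through an explicit function equality: a direct `exact (…).comp hq` makes the unifier unfold `gnoDeficit` and time out)
  have e : (fun p : α × ℝ => gnoDeficit z χ (hub p.1) ε (base p.1 + p.2 • dir p.1)) =
      (fun q : ℍ × GnoCoord L => gnoDeficit z χ q.1 ε q.2) ∘ (fun p : α × ℝ => ((hub p.1, base p.1 + p.2 • dir p.1) : ℍ × GnoCoord L)) := by
    funext p; simp only [Function.comp_apply]
  rw [e]
  exact Measurable.comp (measurable_gnoDeficit_uncurry z χ ε) hq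

/-- ★★ **The first ray derivative of `F̂` is measurable in (hub, base point, direction)**: for measurable `hub` (never `0`), `base`, `dir`,
`x ↦ (d/ds) F̂(hub x, ε, base x + s·dir x)|₀` is measurable. [folklore] -/
theorem measurable_rayDeriv_gnoDeficit_param (z : Fin 3 → Bool) (χ : Site 3 L → SU2) (ε : GnoSign L) {hub : α → ℍ} (hhub : Measurable hub)
    (hne : ∀ x, hub x ≠ 0) {base dir : α → GnoCoord L} (hbase : Measurable base) (hdir : Measurable dir) :
    Measurable fun x : α => deriv (fun s : ℝ => gnoDeficit z χ (hub x) ε (base x + s • dir x)) 0 :=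
  measurable_deriv_param_at (measurable_gnoDeficit_ray_uncurry z χ ε hhub hbase hdir)
    (fun x s => ((contDiff_gnoDeficit_ray z χ (hne x) ε (base x) (dir x) (n := 1)).differentiable (by norm_num)).differentiableAt) 0

/-- ★★ **The second ray derivative of `F̂` is measurable in (hub, base point, direction)** — the `hAm` socket with a VARYING hub: for measurable `hub` (never `0`),
`base`, `dir`, `x ↦ (d²/ds²) F̂(hub x, ε, base x + s·dir x)|₀ = iteratedDeriv 2 (…) 0` is measurable. [folklore] -/
theorem measurable_raySecond_gnoDeficit_param (z : Fin 3 → Bool) (χ : Site 3 L → SU2) (ε : GnoSign L) {hub : α → ℍ} (hhub : Measurable hub)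
    (hne : ∀ x, hub x ≠ 0) {base dir : α → GnoCoord L} (hbase : Measurable base) (hdir : Measurable dir) :
    Measurable fun x : α => iteratedDeriv 2 (fun s : ℝ => gnoDeficit z χ (hub x) ε (base x + s • dir x)) 0 :=
  measurable_iteratedDeriv_two_param (measurable_gnoDeficit_ray_uncurry z χ ε hhub hbase hdir)
    (fun x => contDiff_gnoDeficit_ray z χ (hne x) ε (base x) (dir x) (n := 2)) 0

/-- ★ **Polarised form**: the mixed second ray derivative `(d²/ds²)F̂(… + s(ζ+ζ′)) − (d²/ds²)F̂(… + sζ) − (d²/ds²)F̂(… + sζ′)` (twice the Hessian form `D²F̂[ζ,ζ′]`) is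
measurable in all data — so every Hessian MATRIX ENTRY in a measurable frame, and hence `p ↦ det A(p)`, is measurable. [folklore] -/
theorem measurable_raySecond_polar_gnoDeficit_param (z : Fin 3 → Bool) (χ : Site 3 L → SU2) (ε : GnoSign L) {hub : α → ℍ} (hhub : Measurable hub)
    (hne : ∀ x, hub x ≠ 0) {base dir dir' : α → GnoCoord L} (hbase : Measurable base) (hdir : Measurable dir) (hdir' : Measurable dir') :
    Measurable fun x : α =>
      iteratedDeriv 2 (fun s : ℝ => gnoDeficit z χ (hub x) ε (base x + s • (dir x + dir' x))) 0 -
        iteratedDeriv 2 (fun s : ℝ => gnoDeficit z χ (hub x) ε (base x + s • dir x)) 0 -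
        iteratedDeriv 2 (fun s : ℝ => gnoDeficit z χ (hub x) ε (base x + s • dir' x)) 0 :=
  ((measurable_raySecond_gnoDeficit_param z χ ε hhub hne hbase (hdir.add hdir')).sub
    (measurable_raySecond_gnoDeficit_param z χ ε hhub hne hbase hdir)).sub (measurable_raySecond_gnoDeficit_param z χ ε hhub hne hbase hdir')

end Model

end Summit.QuantumFields.YangMills.Theorems.SwapVirialDeficit.BlowUpRing

end
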